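import Literature.MathematicalPhysics.QuantumFieldTheory.Balaban1983to89.B8Ineq159PeriodizedTowerClass
import Literature.MathematicalPhysics.QuantumFieldTheory.Balaban1983to89.B8SockB9P3H2AtTopCubeTower
import Literature.MathematicalPhysics.QuantumFieldTheory.Balaban1983to89.B8Ineq159TopCubeTowerSourceReads

/-!
# `Balaban1983to89.B8SockB9P3H2AtPeriodizedTower` — [Balaban1985RegularSpaces] (1.57)–(1.59) p. 86, (1.31) p. 82, (1.131) p. 99, p. 77 («we admit the case when
# some domains Ω_j are equal to T_η»): THE b9-SOCKETS OF PROPOSITION 3's FRAME (`SockB9P3H2`, `SockB9P3`) HOLD AT THE PERIODISED SECT.-F TOWER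
# `Ωᴾ = periodize (fun _ ↦ P) (cubeFam true L a M ρ k)` WITH THE PRINTED CLASS `towerBondsP` OVER PRINT'S LEVEL SETS, PER SHAPE — constants independent of the
# period `P` (beyond the separation `Lᵏ·M + 2·ρ·gs L k ≤ P`), of the centre `a` and of the spacing `η`

statement-level skeleton of published theorems with citation tags; proofs where landed; nothing here is a claim about the
Yang–Mills mass gap

`[Balaban1985RegularSpaces]` ("B8", CMP **99** (1985) 75–102) (1.36)–(1.38) p. 82, (1.55)–(1.59) p. 86, (1.7) p. 77, (1.31) p. 82, (1.131) p. 99, p. 77 («Ω_j = T_η»),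
p. 98 (§3: «this analysis can be reduced to the analysis of the operators … with periodic boundary conditions»); [4] = `[Balaban1985BackgroundPropagators]` Thm 3.3
p. 399, (3.40)–(3.47) pp. 397–398; [B6] = `[Balaban1984PropagatorsII]` (2.1)–(2.3) p. 224; [B7] = `[Balaban1985Averaging]` Prop. 5 p. 42.

CITATION HEADER (lean-in-tree rule).  Cell `pub-ymgap` (YM Track A, HUMAN RULING D-0062 ∕ D-0149), node N05 = [B8], width seat `pub-ymgap-dag-n05-w3` (g5), CLAIM-1
file (B); director-ym №217 (1) «(β′-PERIODIC) is the road of record behind the [B8] display»; dag-n05-w2 g6 CLAIM-2 (e)(f): the periodised Sect.-F tower is a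
`P`-periodic (1.5)-member for `Lᵏ ∣ P`, NOT the all-torus tower once `P` exceeds the side of `□₁`.  WHY.  g4's `B8SockB9P3H2AtTopCubeTower` inhabits the `SB9P`
binder's body at print's top-cube tower `(T, □₁, …, □_k)` read on `ℤᵈ`; on the periodic road the member is the tower read on the torus, i.e. on the cover the union
`Ωᴾ` of its period translates.  THIS FILE runs the top-cube proof TRANSLATE-WISE: the per-cube curved (1.59) of `B8Ineq159CurvedCubeMemberUniform` (file (U)) is
UNIFORM IN THE POSITION, so ONE pair `(α₀, B″)` serves every translate `□₀(a + q•v)`; the dictionary `B8Ineq159PeriodizedTowerReads` ∕ `B8Ineq159PeriodizedTowerClass`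
(files (A1)∕(A2): separation, `Lam`, touching ∕ `towerBondsP`, the Landau transfer) localises every question about `Ωᴾ` near a translate to the single tower over it.

THE MATHEMATICS (kernel-checked).  ★★ `socketLines_periodize` (lines 1–4 of (1.59) + the weighted Hölder line over ANY pair class inside the admissible pairs; the
sockets' binders VERBATIM at `Ω := Ωᴾ`, `Λb := towerBondsP L Ωᴾ (Λs ·)`, `Λs k = Lam L Ωᴾ k` up to the depth); ★★★ `exists_sockB9P3H2_periodize`, ★★★
`exists_sockB9P3_periodize`.  PROOF ROAD: `Ωᴾ₀ = T` makes `|A′| ≤ α₂η⁻¹` GLOBAL; `cP ≤ 1∕2` turns `IsLandau138W` into (1.38) for `A′` at `(T, Lam L Ωᴾ k)`; for each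
translate `v`, (A2) §2 transfers it to the cube member `{□_j(a + q•v)}` for the cut-off `A′·𝟙_{sides touching □₀(a + q•v)}`; the targets `N := |J|₍₋₃₎ + |B₁|` (over
`Ωᴾ` and `towerBondsP L Ωᴾ`) dominate (U)'s hypotheses at `v` ((A2) §1; the off-`□₀(a + q•v)` sides of touching plaquettes are level-`0` class bonds by (A1) §2); (U)
gives `(Lʲη)|A′| ≤ B″N` on the sides of the plaquettes touching `□_j(a + q•v)`; a bond side-touching `Ωᴾ_j`, `j ≥ 1`, side-touches SOME translate's `□_j` ((A1) §4);
a bond touching no `□₁(a + q•v)` is a level-`0` class bond — so `η|A′| ≤ (B″+1)N` EVERYWHERE; lines 2, 4, 5 from that pointwise bound, line 3 is `J = D^{η*}D^η A′`.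
The socket's average family is bounded by [B7] Prop. 5 in the shifted regime `cP·L² ≤ α_Q` on `Ωᴾ` ((A2) §1 box lemma) — g4's FINITENESS of the class fails here.

HONEST SCOPE ∕ A6 — READ THIS.  (a) `B₀ = 4(d+1)(Lᵏ)³(B″+1)`, `B₀β = 4(Lᵏ)²(Lᵏ)^β(B″+1)`, `cP = min{α₀(□), 1∕2, α_Q∕L²}` depend on the SHAPE `(L, M, ρ, k)`, on `β`,
`d`, `𝔹`, `len ≥ 1` — NOT on the period `P` (any `P` with `Lᵏ ∣ P`, `Lᵏ·M + 2·ρ·gs L k ≤ P`), NOT on the centre `a`, NOT on `η`: the positive A6 datum for the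
`SB9P`-shape body at a NESTED `P`-periodic (1.5)-member of the road of record (the periodic twin of g4's p626796); NOT the class-wide binder (ONE `B₀(d, L)` for all
admissible towers and depths = [4] Thm 3.3 = N06's object layer); no letter of [4] assumed or proved; the hypotheses `W` unitary, `InAk … (W·U₀)`, self-adjointness and
«`A′ = 0` off» are idle.  (b) No index ∕ pin ∕ door ∕ model of the periodic road is typed; the member-level corollary at `IdxB8SubD` ∕ `IdxB8SubDPer` members over `Ωᴾ`
is a later one-screen file on dag-n05-w2's `exists_idxB8SubD_periodize_cubeFam`.  (c) Non-vacuity: `U₀ = W = 1`, `A′ = 0`.  Count-neutral; N05 NOT discharged; no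
count claim; one finite `𝕋⁴` programme at fixed `ε`, Bałaban as printed; the YM mass gap (Clay) is NOT proved by any of this — R4 closes the conditional finite-`𝕋⁴`
rung `BalabanLadder.UV` only; nothing continuum ∕ ℝ⁴ ∕ OS.  No `sorry`, no `def`, no `instance`, no `notation`.  Unit `pub-ymgap-dag-n05-w3` (g5), 2026-08-28.
-/

noncomputable section
namespace Literature.MathematicalPhysics.QuantumFieldTheory.Balaban1983to89.B8SockB9P3H2AtPeriodizedTower

open B7Prop1Explicit B7Prop2Explicit B7Prop1Local B7Eq78Linearization
open B7Prop4GeneralLevels (linCovIter)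
open B7Prop5GeneralLevels (thetaGen)
open B8Ineq132 (covDerivFwd covDeriv BondTouches PlaqTouches InAk)
open B8Eq140Level (SideTouches sideTouches_of_bondTouches sideTouches_mono)
open B8Eq146AExpansion (iEta plaqCovDeriv norm_I_eta_smul norm_iEta_le)
open B8Eq143PlaqExpansion (pdiv)
open B8Eq155JBound (Jcur Jcur_def wsup le_wsup wsup_nonneg)
open B8ScaledSupNorm (bondNorm msup weight Bdd msup_le msup_nonneg weight_mul_norm_le_msup weight_neg_natCast scale_pos)
open B8Eq138LandauZd (IsLandau138 IsLandau138W QT covLap logCfg)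
open B8Eq184Proof (cfgExp)
open B8Lemma1NonAbelian (mulCfg)
open B9Eq340HolderZd (hquot AdmPair)
open B8Eq131CubesAdmissible (cubeFam cubeFam_true_zero cubeFam_false_zero cubeFam_false_of_le cubeFam_of_pos)
open B8Eq131Cubes (cube cube_anti gs)
open B8CubeMemberZd (cubeLamS)
open B8Ineq159FlatCubeMemberPrinted (cubeLamBP cubeLamBP_box_subset_pred)
open B8TowerBondsPrinted (towerBondsP)
open B9Ineq3137LocalSup (linCovIter_congr)
open B9SupplySockB9P3ZdGammaUnivDelta2 (SockB9P3H2)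
open B8LeafModelZd3 (SockB9P3)
open B9SupplySockB9P3ZdSocketBoundaryMode (logCfg_cfgExp_of_small exists_ne_fin)
open B8Ineq159CurvedCubeMemberUniform (exists_curved159_perCube_inAk_sup_unitary_uniform)
open B8Ineq159TopCubeTowerReads (Jcur_congr_fld_touch bdd_Jcur_of_bound towerBondsP_congr_levels)
open B8Prop7GlevZd3 (inAk_mono_alpha)
open B9Eq316AveragingTransposeZd (Reg17 alphaQ alphaQ_pos reg17_of_inAk norm_linCovIter_le_of_reg17)
open B8Ineq159TopCubeTowerSourceReads (reg17_shift)
open B8SockB9P3H2AtTopCubeTower (weight_mul_hquot_le)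
open B15LatticeCubeTorus (periodize)
open B8Ineq159PeriodizedTowerReads B8Ineq159PeriodizedTowerClass
-- `Site` alone would resolve to the torus sites of `Setup.lean`; re-export the `ℤ^d` sites of `B7Prop1Explicit`.
export B7Prop1Explicit (Site)
variable {d : ℕ} {𝔹 : Type*} [CStarAlgebra 𝔹] [Nontrivial 𝔹]

/-! ## §1 The five lines at the periodised tower -/

/-- ★★ **THE FIVE LINES OF (1.59) AT THE PERIODISED SECT.-F TOWER, PER SHAPE, FOR ANY HÖLDER PAIR CLASS INSIDE THE ADMISSIBLE PAIRS** (common core of `SockB9P3` ∕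
`SockB9P3H2`): `∃ B₀ B₀β cP > 0` (shape-dependent) before `∀ a η`, period `P = Lᵏ·q` with `Lᵏ·M + 2·ρ·gs L k ≤ P`, `Ω = Ωᴾ`, families with `Λs k = Lam L Ωᴾ k` up to the
depth, and every `memH j ⊆ AdmPair η len`: the socket binders of Proposition 3's frame imply lines 1–4 of (1.59) and the weighted Hölder line over `memH`.
[cite: Balaban1985RegularSpaces, (1.57)–(1.59) p.86, (1.38) p.82, (1.31) p.82, (1.131) p.99, (1.7) p.77, p.77 («Ω_j = T_η»); Balaban1985BackgroundPropagators, Thm 3.3 p.399, (3.40)–(3.47) pp.397–398; Balaban1984PropagatorsII, (2.1)–(2.3) p.224; Balaban1985Averaging, Prop. 5 p.42] -/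
theorem socketLines_periodize [FiniteDimensional ℂ 𝔹] (hd2 : 2 ≤ d) {L : ℕ} (hL2 : 2 ≤ L) (M : ℕ) {ρ : ℕ} (hρ : L ≤ ρ)
    {k : ℕ} (hk : 1 ≤ k) {β : ℝ} (hβ : 0 ≤ β) {len : Site d → ℝ} (hlen : ∀ z : Site d, z ≠ 0 → 1 ≤ len z) :
    ∃ B₀ B₀β cP : ℝ, 0 < B₀ ∧ 0 < B₀β ∧ 0 < cP ∧ ∀ (a : Site d) (η : ℝ), 0 < η →
      ∀ (P : ℕ) (q : ℤ), (L : ℤ) ^ k * q = P → L ^ k * M + 2 * (ρ * gs L k) ≤ P →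
      ∀ (Ω : ℕ → Set (Site d)) (Λs : ℕ → ℕ → Set (Site d)), Ω = periodize (fun _ : Fin d => P) (cubeFam true L a M ρ k) →
      (∀ j, j ≤ k → Λs k j = B11Eq7Convention.Lam L Ω k j) →
      ∀ memH : ℕ → (Fin d × Fin d × (Site d × Site d)) → Prop, (∀ j p, memH j p → p.2.2 ∈ AdmPair η len) →
      ∀ α₀ α₂ : ℝ, 0 < α₀ → α₀ ≤ cP → 0 < α₂ → α₂ ≤ cP →
        ∀ (U₀ W : Site d → Fin d → 𝔹ˣ), (∀ x κ, U₀ x κ ∈ unitaryUnits 𝔹) → (∀ x κ, W x κ ∈ unitaryUnits 𝔹) →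
        InAk L k η α₀ Ω U₀ → InAk L k η α₀ Ω (mulCfg W U₀) →
        IsLandau138W L k η (Ω 0) (Λs k) U₀ W →
        ∀ A' : Site d → Fin d → 𝔹, (∀ y τ, IsSelfAdjoint (A' y τ)) →
        (∀ j, j ≤ k → ∀ (y : Site d) (τ : Fin d), SideTouches (Ω j) y τ →
          W y τ = cfgExp η A' y τ ∧ ‖A' y τ‖ ≤ α₂ * ((L : ℝ) ^ j * η)⁻¹) →
        (∀ (y : Site d) (τ : Fin d), (∀ j, j ≤ k → ¬ SideTouches (Ω j) y τ) → A' y τ = 0) →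
        msup L k η (-(1 : ℝ)) (fun j (b : Site d × Fin d) => SideTouches (Ω j) b.1 b.2) (fun b => A' b.1 b.2)
            ≤ B₀ * (bondNorm L k η (-(3 : ℝ)) Ω (fun x μ => Jcur η U₀ A' μ x)
              + wsup 1 (fun p : {p : ℕ × (Site d × Fin d) // p.1 ≤ k ∧ p.2 ∈ towerBondsP L Ω (Λs k) p.1} =>
                  linCovIter L U₀ (iEta η A') p.1.1 p.1.2.1 p.1.2.2)) ∧
          msup L k η (-(2 : ℝ)) (fun j (t : Fin d × Fin d × Site d) => SideTouches (Ω j) t.2.2 t.2.1)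
              (fun t => covDerivFwd η U₀ t.1 (fun z => A' z t.2.1) t.2.2)
            ≤ B₀ * (bondNorm L k η (-(3 : ℝ)) Ω (fun x μ => Jcur η U₀ A' μ x)
              + wsup 1 (fun p : {p : ℕ × (Site d × Fin d) // p.1 ≤ k ∧ p.2 ∈ towerBondsP L Ω (Λs k) p.1} =>
                  linCovIter L U₀ (iEta η A') p.1.1 p.1.2.1 p.1.2.2)) ∧
          bondNorm L k η (-(3 : ℝ)) Ω (fun x μ => pdiv η U₀ (plaqCovDeriv η U₀ A') μ x)
            ≤ B₀ * (bondNorm L k η (-(3 : ℝ)) Ω (fun x μ => Jcur η U₀ A' μ x)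
              + wsup 1 (fun p : {p : ℕ × (Site d × Fin d) // p.1 ≤ k ∧ p.2 ∈ towerBondsP L Ω (Λs k) p.1} =>
                  linCovIter L U₀ (iEta η A') p.1.1 p.1.2.1 p.1.2.2)) ∧
          bondNorm L k η (-(3 : ℝ)) Ω (fun x μ => covLap η U₀ (fun z => A' z μ) x)
            ≤ B₀ * (bondNorm L k η (-(3 : ℝ)) Ω (fun x μ => Jcur η U₀ A' μ x)
              + wsup 1 (fun p : {p : ℕ × (Site d × Fin d) // p.1 ≤ k ∧ p.2 ∈ towerBondsP L Ω (Λs k) p.1} =>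
                  linCovIter L U₀ (iEta η A') p.1.1 p.1.2.1 p.1.2.2)) ∧
          msup L k η (-(2 + β)) memH (fun p => hquot η β len U₀ (covDerivFwd η U₀ p.1 (fun z => A' z p.2.1)) p.2.2)
            ≤ B₀β * (bondNorm L k η (-(3 : ℝ)) Ω (fun x μ => Jcur η U₀ A' μ x)
              + wsup 1 (fun p : {p : ℕ × (Site d × Fin d) // p.1 ≤ k ∧ p.2 ∈ towerBondsP L Ω (Λs k) p.1} =>
                  linCovIter L U₀ (iEta η A') p.1.1 p.1.2.1 p.1.2.2)) := by
  classical
  obtain ⟨α₀, B'', hα₀, hB'', H⟩ := exists_curved159_perCube_inAk_sup_unitary_uniform (𝔹 := 𝔹) hd2 hL2 M hρ (k := k) (m := k) hk le_rfl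
  have hL1 : 1 ≤ L := le_trans (by norm_num) hL2
  have hρ1 : 1 ≤ ρ := hL1.trans hρ
  have hL1r : (1 : ℝ) ≤ L := by exact_mod_cast hL1
  have hLk1 : (1 : ℝ) ≤ (L : ℝ) ^ k := one_le_pow₀ hL1r
  set P₀ : ℝ := B'' + 1 with hP₀
  have hP₀0 : 0 < P₀ := by positivity
  have hBP : B'' ≤ P₀ := by linarith
  -- the threshold: (U)'s `α₀`, the principal-log branch `1/2`, and [B7] Prop. 5's regime `α·L² ≤ α_Q`
  obtain ⟨cP, hcP⟩ : ∃ c : ℝ, c = min (min α₀ (1 / 2)) (alphaQ d L / (L : ℝ) ^ 2) := ⟨_, rfl⟩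
  have hcPpos : 0 < cP := by rw [hcP]; exact lt_min (lt_min hα₀ (by norm_num)) (div_pos (alphaQ_pos d hL1) (by positivity))
  have hcPα : cP ≤ α₀ := by rw [hcP]; exact (min_le_left _ _).trans (min_le_left _ _)
  have hcPh : cP ≤ 1 / 2 := by rw [hcP]; exact (min_le_left _ _).trans (min_le_right _ _)
  have hcPQ : cP * (L : ℝ) ^ 2 ≤ alphaQ d L := by
    have h : cP ≤ alphaQ d L / (L : ℝ) ^ 2 := by rw [hcP]; exact min_le_right _ _
    calc cP * (L : ℝ) ^ 2 ≤ alphaQ d L / (L : ℝ) ^ 2 * (L : ℝ) ^ 2 := mul_le_mul_of_nonneg_right h (by positivity)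
      _ = alphaQ d L := div_mul_cancel₀ _ (by positivity)
  refine ⟨4 * ((d : ℝ) + 1) * ((L : ℝ) ^ k) ^ 3 * P₀, 4 * ((L : ℝ) ^ k) ^ 2 * ((L : ℝ) ^ k) ^ β * P₀, cP,
    by positivity, by positivity, hcPpos, ?_⟩
  intro a η hη P q hq hP Ω Λs hΩ hΛs memH hmemH α₀' α₂ hα₀' hα₀'c hα₂ hα₂c U₀ W hU₀ _hW hAk _hAkW hLanW A' _hsa h41 _hA0
  subst hΩ
  set Ω : ℕ → Set (Site d) := periodize (fun _ : Fin d => P) (cubeFam true L a M ρ k) with hΩdef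
  have hU1 : ∀ x κ, U₀ x κ ∈ U1 𝔹 := fun x κ => unitaryUnits_le_U1 (hU₀ x κ)
  have hΩ0 : Ω 0 = Set.univ := periodize_cubeFam_true_zero P L a M ρ k
  -- (0) `Ω₀ = T`: the (1.41) clause at level `0` is GLOBAL; `W = e^{iηA′}`, `(1/iη) log W = A′`
  have hST0 : ∀ (y : Site d) (τ : Fin d), SideTouches (Ω 0) y τ := fun y τ => by
    obtain ⟨κ, hκ⟩ := exists_ne_fin hd2 τ
    rw [hΩ0]
    exact sideTouches_of_bondTouches hκ (Or.inl (Set.mem_univ y))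
  have hAb : ∀ (y : Site d) (τ : Fin d), ‖A' y τ‖ ≤ α₂ * η⁻¹ := fun y τ => by
    have h := (h41 0 (Nat.zero_le k) y τ (hST0 y τ)).2
    rwa [pow_zero, one_mul] at h
  have hα₂η : 0 ≤ α₂ * η⁻¹ := by positivity
  have hWexp : W = cfgExp η A' := funext fun y => funext fun τ => (h41 0 (Nat.zero_le k) y τ (hST0 y τ)).1
  have hlog : logCfg η W = A' := by
    rw [hWexp]
    refine logCfg_cfgExp_of_small hη fun y τ => ?_
    have h1 : η * ‖A' y τ‖ ≤ α₂ := by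
      calc η * ‖A' y τ‖ ≤ η * (α₂ * η⁻¹) := mul_le_mul_of_nonneg_left (hAb y τ) hη.le
        _ = α₂ := by field_simp
    have h2 : α₂ ≤ 1 / 2 := hα₂c.trans hcPh
    linarith [Real.log_two_gt_d9]
  -- the member's restriction families ARE print's level sets of `Ω` up to the depth
  have hTB : ∀ j, j ≤ k → towerBondsP L Ω (Λs k) j = towerBondsP L Ω (B11Eq7Convention.Lam L Ω k) j := fun j hj =>
    towerBondsP_congr_levels L Ω j (hΛs j hj) (hΛs (j - 1) (by omega))
  have hLanA : IsLandau138 L k η (Set.univ : Set (Site d)) (B11Eq7Convention.Lam L Ω k) U₀ A' := by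
    have h := hLanW
    unfold IsLandau138W at h
    rw [hlog, hΩ0] at h
    obtain ⟨μ, hμ⟩ := h
    refine ⟨μ, fun x hx => ?_⟩
    rw [hμ x hx]
    unfold QT
    exact Finset.sum_congr rfl fun j hj => by rw [hΛs j (Nat.lt_succ_iff.mp (Finset.mem_range.mp hj))]
  -- the backgrounds: (U)'s class and [B7] Prop. 5's shifted regime on `Ω`
  have hAk0 : InAk L k η α₀ Ω U₀ := inAk_mono_alpha hη (hα₀'c.trans hcPα) hAk
  have hAkP : InAk L k η cP Ω U₀ := inAk_mono_alpha hη hα₀'c hAk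
  have hreg : Reg17 L k (fun j => Ω (j - 1)) (cP * (L : ℝ) ^ 2) U₀ := reg17_shift hL1 hcPpos.le (reg17_of_inAk hAkP le_rfl)
  -- the targets `N := |J|₍₋₃₎ + |B₁|`
  set N : ℝ := bondNorm L k η (-(3 : ℝ)) Ω (fun x μ => Jcur η U₀ A' μ x) +
    wsup 1 (fun p : {p : ℕ × (Site d × Fin d) // p.1 ≤ k ∧ p.2 ∈ towerBondsP L Ω (Λs k) p.1} =>
      linCovIter L U₀ (iEta η A') p.1.1 p.1.2.1 p.1.2.2) with hN
  have hN0 : 0 ≤ N := add_nonneg (msup_nonneg L k hη.le _ _ _) (wsup_nonneg zero_le_one _)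
  have hBJ := bdd_Jcur_of_bound hL1 hη hU1 k Ω hα₂η hAb
  have hiEta : ∀ (y : Site d) (τ : Fin d), ‖iEta η A' y τ‖ ≤ η * (α₂ * η⁻¹) := fun y τ => norm_iEta_le hη.le hAb y τ
  -- the average family is BOUNDED: [B7] Prop. 5 in the regime at every class bond (the fine box lies in `Ω_{j−1}`, (A2) §1)
  have hCavg : ∀ p : {p : ℕ × (Site d × Fin d) // p.1 ≤ k ∧ p.2 ∈ towerBondsP L Ω (Λs k) p.1},
      1 * ‖linCovIter L U₀ (iEta η A') p.1.1 p.1.2.1 p.1.2.2‖ ≤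
        2 * d * ((1 + thetaGen d L (cP * (L : ℝ) ^ 2)) * (L : ℝ) ^ k) * (η * (α₂ * η⁻¹)) := by
    rintro ⟨⟨j, c⟩, hj, hc⟩
    rw [one_mul]
    have hc' : c ∈ towerBondsP L Ω (B11Eq7Convention.Lam L Ω k) j := by rw [← hTB j hj]; exact hc
    have hbox := box_subset_periodize_pred_of_mem_towerBondsP a M ρ k hq hc'
    refine (norm_linCovIter_le_of_reg17 hL2 (by positivity) hcPQ hU₀ hreg hj c.1 c.2 hbox (iEta η A') (by positivity)
      (fun y μ _ => hiEta y μ)).trans ?_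
    have hθ : 0 ≤ thetaGen d L (cP * (L : ℝ) ^ 2) := by unfold thetaGen; positivity
    have hLj : (L : ℝ) ^ j ≤ (L : ℝ) ^ k := pow_le_pow_right₀ hL1r hj
    gcongr
  have hNJ : ∀ j, j ≤ k → ∀ (x : Site d) (μ : Fin d), BondTouches (Ω j) x μ →
      ((L : ℝ) ^ j * η) ^ 3 * ‖Jcur η U₀ A' μ x‖ ≤ N := by
    intro j hj x μ hb
    have h := weight_mul_norm_le_msup hBJ hj (i := (x, μ)) hb
    have e3 : (-(3 : ℝ)) = -((3 : ℕ) : ℝ) := by norm_num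
    rw [e3, weight_neg_natCast] at h
    exact h.trans (le_add_of_nonneg_right (wsup_nonneg zero_le_one _))
  have hNavg : ∀ j, j ≤ k → ∀ c ∈ towerBondsP L Ω (B11Eq7Convention.Lam L Ω k) j, ‖linCovIter L U₀ (iEta η A') j c.1 c.2‖ ≤ N := by
    intro j hj c hc
    have hc' : c ∈ towerBondsP L Ω (Λs k) j := by rw [hTB j hj]; exact hc
    have h := le_wsup hCavg ⟨(j, c), hj, hc'⟩
    rw [one_mul] at h
    exact h.trans (le_add_of_nonneg_left (msup_nonneg L k hη.le _ _ _))
  -- ★ THE PER-CUBE ANALYSIS AT EACH TRANSLATE `a + q•v`: `(Lʲη)|A′| ≤ B″N` on the sides of the plaquettes touching `□_j(a + q•v)`, `j ≥ 1`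
  have hmainA : ∀ (v : Site d) (j : ℕ), 1 ≤ j → j ≤ k → ∀ (y : Site d) (τ : Fin d), SideTouches (cube L (a + q • v) M ρ k j) y τ →
      ((L : ℝ) ^ j * η) * ‖A' y τ‖ ≤ B'' * N := by
    intro v j hj1 hj y τ hs
    -- the cut-off field at this translate
    set φ : Site d → Fin d → 𝔹 := fun y τ => if SideTouches (cube L (a + q • v) M ρ k 0) y τ then A' y τ else 0 with hφ
    have hφS : ∀ (y : Site d) (τ : Fin d), SideTouches (cube L (a + q • v) M ρ k 0) y τ → φ y τ = A' y τ := fun y τ hs => by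
      show (if SideTouches (cube L (a + q • v) M ρ k 0) y τ then A' y τ else 0) = A' y τ
      rw [if_pos hs]
    have hφN : ∀ (y : Site d) (τ : Fin d), ¬ SideTouches (cube L (a + q • v) M ρ k 0) y τ → φ y τ = 0 := fun y τ hs => by
      show (if SideTouches (cube L (a + q • v) M ρ k 0) y τ then A' y τ else 0) = 0
      rw [if_neg hs]
    have hφA : ∀ (y : Site d) (τ : Fin d), BondTouches (cube L (a + q • v) M ρ k 0) y τ → φ y τ = A' y τ := fun y τ hb => by
      obtain ⟨κ, hκ⟩ := exists_ne_fin hd2 τ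
      exact hφS y τ (sideTouches_of_bondTouches hκ hb)
    have hLanφ : IsLandau138 L k η (cubeFam false L (a + q • v) M ρ k 0) (cubeLamS L (a + q • v) M ρ k k) U₀ φ :=
      isLandau138_cube_of_periodize hL1 a M hρ hq hP hk v hφA hLanA
    have hφ0 : ∀ (y : Site d) (τ : Fin d), (∀ j, j ≤ k → ¬ SideTouches (cubeFam false L (a + q • v) M ρ k j) y τ) → φ y τ = 0 :=
      fun y τ h => hφN y τ (by have h0 := h 0 (Nat.zero_le k); rwa [cubeFam_false_zero] at h0)
    have hsub : cubeFam false L (a + q • v) M ρ k 0 ⊆ Ω 0 := by rw [hΩ0]; exact Set.subset_univ _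
    have HJ : ∀ j, j ≤ k → ∀ (y : Site d) (τ : Fin d), BondTouches (cubeFam false L (a + q • v) M ρ k j) y τ →
        ((L : ℝ) ^ j * η) ^ 3 * ‖Jcur η U₀ φ τ y‖ ≤ N := by
      intro j hj y τ hb
      rw [cubeFam_false_of_le L _ M ρ hj] at hb
      have hb0 : BondTouches (cube L (a + q • v) M ρ k 0) y τ := by
        rcases hb with h | h
        exacts [Or.inl (cube_anti (Nat.zero_le j) hj h), Or.inr (cube_anti (Nat.zero_le j) hj h)]
      rw [Jcur_congr_fld_touch hb0 hφS]
      refine hNJ j hj y τ ?_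
      rcases Nat.eq_zero_or_pos j with rfl | hj1'
      · rw [hΩ0]; exact Or.inl (Set.mem_univ y)
      · exact bondTouches_periodize_of_translate a M ρ hq hj1' hj v hb
    have Havg : ∀ j, j ≤ k → ∀ c ∈ cubeLamBP L (a + q • v) M ρ k k j, ‖linCovIter L U₀ (iEta η φ) j c.1 c.2‖ ≤ N := by
      intro j hj c hc
      rcases Nat.eq_zero_or_pos j with rfl | hj1'
      · -- level `0`: the average is the field itself, the class bond touches `□₀(a + q•v)`
        have hb0 : BondTouches (cube L (a + q • v) M ρ k 0) c.1 c.2 := by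
          obtain ⟨-, hends, -⟩ := hc
          exact hends
        have e0 : linCovIter L U₀ (iEta η φ) 0 c.1 c.2 = linCovIter L U₀ (iEta η A') 0 c.1 c.2 := by
          show iEta η φ c.1 c.2 = iEta η A' c.1 c.2
          simp only [iEta, hφA c.1 c.2 hb0]
        rw [e0]
        exact hNavg 0 hj c (cubeLamBP_translate_zero_subset_towerBondsP_periodize hL1 a M hρ hq hP hk v hc)
      · have hjk : j - 1 ≤ k := by omega
        have e1 : linCovIter L U₀ (iEta η φ) j c.1 c.2 = linCovIter L U₀ (iEta η A') j c.1 c.2 :=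
          linCovIter_congr L hL1 j c.1 c.2 (fun _ _ _ _ => rfl) fun z κ hz _ => by
            simp only [iEta, hφA z κ (Or.inl (cube_anti (Nat.zero_le _) hjk
              (cubeLamBP_box_subset_pred hL1 (a + q • v) M hρ hj1' le_rfl hc z hz)))]
        rw [e1]
        exact hNavg j hj c (cubeLamBP_translate_subset_towerBondsP_periodize hL1 a M hρ hq hP v hj1' hj hc)
    have Hout : ∀ (y : Site d) (τ : Fin d), ¬ BondTouches (cubeFam false L (a + q • v) M ρ k 0) y τ → η * ‖φ y τ‖ ≤ N := by
      intro y τ hnb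
      rw [cubeFam_false_zero] at hnb
      by_cases hs0 : SideTouches (cube L (a + q • v) M ρ k 0) y τ
      · -- an off-`□₀(a + q•v)` side of a touching plaquette: a level-`0` class bond of `Ω`, read by `|B₁|`
        rw [hφS y τ hs0, ← norm_I_eta_smul hη.le]
        have hends := ends_not_mem_cube_one_of_sideTouches a M hq hP hρ1 hk hs0 hnb
        exact hNavg 0 (Nat.zero_le k) (y, τ)
          (mem_towerBondsP_periodize_zero_of_ends a M ρ hq hk (fun w => (hends w).1) fun w => (hends w).2)
      · rw [hφN y τ hs0, norm_zero, mul_zero]; exact hN0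
    have hm := H (a + q • v) η hη U₀ hU₀ Ω k hsub hAk0 φ hLanφ hφ0 N hN0 HJ Havg Hout
    have hs' : SideTouches (cubeFam false L (a + q • v) M ρ k j) y τ := by rwa [cubeFam_false_of_le L _ M ρ hj]
    have h := (hm j hj y τ hs').1
    rwa [hφS y τ (sideTouches_mono (cube_anti (Nat.zero_le j) hj) hs)] at h
  -- ★ THE POINTWISE BOUND EVERYWHERE: a bond touches some translate's `□₁` (per-cube analysis at level `1`) or none (level-`0` class bond)
  have POINT : ∀ (y : Site d) (τ : Fin d), η * ‖A' y τ‖ ≤ P₀ * N := by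
    intro y τ
    by_cases hb1 : ∃ v : Site d, BondTouches (cube L (a + q • v) M ρ k 1) y τ
    · obtain ⟨v, hb1⟩ := hb1
      obtain ⟨κ, hκ⟩ := exists_ne_fin hd2 τ
      have h := hmainA v 1 le_rfl hk y τ (sideTouches_of_bondTouches hκ hb1)
      rw [pow_one] at h
      calc η * ‖A' y τ‖ ≤ (L : ℝ) * η * ‖A' y τ‖ := by
            rw [mul_assoc]; exact le_mul_of_one_le_left (by positivity) hL1r
        _ ≤ B'' * N := h
        _ ≤ P₀ * N := mul_le_mul_of_nonneg_right hBP hN0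
    · push Not at hb1
      have h1 : ∀ w : Site d, y ∉ cube L (a + q • w) M ρ k 1 := fun w h => hb1 w (Or.inl h)
      have h2 : ∀ w : Site d, y + e τ ∉ cube L (a + q • w) M ρ k 1 := fun w h => hb1 w (Or.inr h)
      have h := hNavg 0 (Nat.zero_le k) (y, τ) (mem_towerBondsP_periodize_zero_of_ends a M ρ hq hk h1 h2)
      have e0 : linCovIter L U₀ (iEta η A') 0 (y, τ).1 (y, τ).2 = ((Complex.I : ℂ) * η) • A' y τ := rfl
      rw [e0, norm_I_eta_smul hη.le] at h
      exact h.trans (le_mul_of_one_le_left hN0 (by linarith))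
  have POINT' : ∀ (y : Site d) (τ : Fin d), ‖A' y τ‖ ≤ P₀ * N * η⁻¹ := fun y τ => by
    rw [le_mul_inv_iff₀ hη, mul_comm]; exact POINT y τ
  have hB1 : P₀ ≤ 4 * ((d : ℝ) + 1) * ((L : ℝ) ^ k) ^ 3 * P₀ := by
    have : (1 : ℝ) ≤ 4 * ((d : ℝ) + 1) * ((L : ℝ) ^ k) ^ 3 := by nlinarith [one_le_pow₀ (n := 3) hLk1]
    nlinarith
  have hB2 : 2 * ((L : ℝ) ^ k) ^ 2 * P₀ ≤ 4 * ((d : ℝ) + 1) * ((L : ℝ) ^ k) ^ 3 * P₀ :=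
    mul_le_mul_of_nonneg_right ((mul_le_mul_of_nonneg_left (pow_le_pow_right₀ hLk1 (by norm_num : 2 ≤ 3)) (by norm_num)).trans
      (mul_le_mul_of_nonneg_right (by linarith) (by positivity))) hP₀0.le
  have hB4 : 4 * (d : ℝ) * ((L : ℝ) ^ k) ^ 3 * P₀ ≤ 4 * ((d : ℝ) + 1) * ((L : ℝ) ^ k) ^ 3 * P₀ := by nlinarith [one_le_pow₀ (n := 3) hLk1]
  have hB3 : (1 : ℝ) ≤ 4 * ((d : ℝ) + 1) * ((L : ℝ) ^ k) ^ 3 * P₀ := le_trans (by linarith) hB1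
  have hLj : ∀ j, j ≤ k → (L : ℝ) ^ j ≤ (L : ℝ) ^ k := fun j hj => pow_le_pow_right₀ hL1r hj
  refine ⟨?_, ?_, ?_, ?_, ?_⟩
  · -- LINE 1: `|A′|₍₋₁₎ ≤ B₀·N`
    refine msup_le (by positivity) fun j hj b hb => ?_
    have e1 : (-(1 : ℝ)) = -((1 : ℕ) : ℝ) := by norm_num
    rw [e1, weight_neg_natCast, pow_one]
    rcases Nat.eq_zero_or_pos j with rfl | hj1
    · rw [pow_zero, one_mul]
      exact (POINT b.1 b.2).trans (mul_le_mul_of_nonneg_right hB1 hN0)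
    · obtain ⟨v, hv⟩ := exists_translate_of_sideTouches_periodize a M ρ hq hj1 hj hb
      exact (hmainA v j hj1 hj b.1 b.2 hv).trans (mul_le_mul_of_nonneg_right (hBP.trans hB1) hN0)
  · -- LINE 2: `|∇A′|₍₋₂₎ ≤ B₀·N` from the pointwise bound
    refine msup_le (by positivity) fun j hj t _ => ?_
    have e2 : (-(2 : ℝ)) = -((2 : ℕ) : ℝ) := by norm_num
    rw [e2, weight_neg_natCast]
    have hD := B8Ineq159StencilsNearFlat.norm_covDerivFwd_le hU1 hη t.1 (fun z => A' z t.2.1) t.2.2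
    calc ((L : ℝ) ^ j * η) ^ 2 * ‖covDerivFwd η U₀ t.1 (fun z => A' z t.2.1) t.2.2‖
        ≤ ((L : ℝ) ^ k * η) ^ 2 * (η⁻¹ * (‖A' (t.2.2 + e t.1) t.2.1‖ + ‖A' t.2.2 t.2.1‖)) :=
          mul_le_mul (pow_le_pow_left₀ (by positivity) (mul_le_mul_of_nonneg_right (hLj j hj) hη.le) 2) hD (norm_nonneg _) (by positivity)
      _ = ((L : ℝ) ^ k) ^ 2 * (η * ‖A' (t.2.2 + e t.1) t.2.1‖ + η * ‖A' t.2.2 t.2.1‖) := by field_simp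
      _ ≤ ((L : ℝ) ^ k) ^ 2 * (P₀ * N + P₀ * N) := mul_le_mul_of_nonneg_left (add_le_add (POINT _ _) (POINT _ _)) (by positivity)
      _ = 2 * ((L : ℝ) ^ k) ^ 2 * P₀ * N := by ring
      _ ≤ 4 * ((d : ℝ) + 1) * ((L : ℝ) ^ k) ^ 3 * P₀ * N := mul_le_mul_of_nonneg_right hB2 hN0
  · -- LINE 3: `|D^{η*}D^η A′|₍₋₃₎ = |J|₍₋₃₎ ≤ N ≤ B₀·N`
    calc bondNorm L k η (-(3 : ℝ)) Ω (fun x μ => pdiv η U₀ (plaqCovDeriv η U₀ A') μ x)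
        = bondNorm L k η (-(3 : ℝ)) Ω (fun x μ => Jcur η U₀ A' μ x) := rfl
      _ ≤ N := le_add_of_nonneg_right (wsup_nonneg zero_le_one _)
      _ ≤ 4 * ((d : ℝ) + 1) * ((L : ℝ) ^ k) ^ 3 * P₀ * N := le_mul_of_one_le_left hN0 hB3
  · -- LINE 4: `|Δ^η_{U₀}A′|₍₋₃₎ ≤ B₀·N` from the pointwise bound
    refine msup_le (by positivity) fun j hj b _ => ?_
    have e3 : (-(3 : ℝ)) = -((3 : ℕ) : ℝ) := by norm_num
    rw [e3, weight_neg_natCast]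
    have hC := B8Ineq159StencilsNearFlat.norm_covLap_le hU1 hη (g := fun z => A' z b.2) (fun z => POINT' z b.2) b.1
    calc ((L : ℝ) ^ j * η) ^ 3 * ‖covLap η U₀ (fun z => A' z b.2) b.1‖
        ≤ ((L : ℝ) ^ k * η) ^ 3 * (4 * d * (η ^ 2)⁻¹ * (P₀ * N * η⁻¹)) :=
          mul_le_mul (pow_le_pow_left₀ (by positivity) (mul_le_mul_of_nonneg_right (hLj j hj) hη.le) 3) hC (norm_nonneg _) (by positivity)
      _ = 4 * d * ((L : ℝ) ^ k) ^ 3 * P₀ * N := by field_simp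
      _ ≤ 4 * ((d : ℝ) + 1) * ((L : ℝ) ^ k) ^ 3 * P₀ * N := mul_le_mul_of_nonneg_right hB4 hN0
  · -- LINE 5: the both-points Hölder line from the pointwise derivative bound
    refine msup_le (by positivity) fun j hj p hp => ?_
    have hp' := hmemH j p hp
    have hD : ∀ z, η ^ 2 * ‖covDerivFwd η U₀ p.1 (fun w => A' w p.2.1) z‖ ≤ 2 * P₀ * N := by
      intro z
      have h := B8Ineq159StencilsNearFlat.norm_covDerivFwd_le hU1 hη p.1 (fun w => A' w p.2.1) z
      calc η ^ 2 * ‖covDerivFwd η U₀ p.1 (fun w => A' w p.2.1) z‖ ≤ η ^ 2 * (η⁻¹ * (‖A' (z + e p.1) p.2.1‖ + ‖A' z p.2.1‖)) :=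
            mul_le_mul_of_nonneg_left h (by positivity)
        _ = η * ‖A' (z + e p.1) p.2.1‖ + η * ‖A' z p.2.1‖ := by field_simp
        _ ≤ P₀ * N + P₀ * N := add_le_add (POINT _ _) (POINT _ _)
        _ = 2 * P₀ * N := by ring
    have h := weight_mul_hquot_le hL1 hη hβ hlen hU1 (by positivity) hD hj (x := p.2.2.1) (x' := p.2.2.2) hp'
    calc weight L η (-(2 + β)) j * ‖hquot η β len U₀ (covDerivFwd η U₀ p.1 fun w => A' w p.2.1) p.2.2‖
        ≤ 2 * ((L : ℝ) ^ k) ^ 2 * ((L : ℝ) ^ k) ^ β * (2 * P₀ * N) := h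
      _ = 4 * ((L : ℝ) ^ k) ^ 2 * ((L : ℝ) ^ k) ^ β * P₀ * N := by ring

/-! ## §2 The two sockets of Proposition 3's frame at the periodised tower -/

/-- ★★★ **THE b9-SOCKET `SockB9P3H2` OF PROPOSITION 3's FRAME (the `SB9P` binder's shape) HOLDS AT THE PERIODISED SECT.-F TOWER WITH THE PRINTED CLASS `towerBondsP`
OVER PRINT'S LEVEL SETS, PER SHAPE**: `∃ B₀ B₀β cP > 0` (shape-dependent) before `∀ a η P Λs` (`Lᵏ ∣ P`, `Lᵏ·M + 2·ρ·gs L k ≤ P`, `Λs k = Lam L Ωᴾ k` up to the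
depth): the five lines of (1.59) for unitary `U₀ ∈ 𝔄_k(Ωᴾ, α₀)`, `W = e^{iηA′}` in the Landau gauge (1.38), `|A′| ≤ α₂(Lʲη)⁻¹`.  NOT [4] Thm 3.3's `B₀(d, L)`. [cite: Balaban1985RegularSpaces, (1.57)–(1.59) p.86, (1.38) p.82, (1.31) p.82, (1.131) p.99, (1.7) p.77, p.77 («Ω_j = T_η»); Balaban1985BackgroundPropagators, Thm 3.3 p.399, (3.43), (3.47) p.398; Balaban1984PropagatorsII, (2.1)–(2.3) p.224] -/
theorem exists_sockB9P3H2_periodize [FiniteDimensional ℂ 𝔹] (hd2 : 2 ≤ d) {L : ℕ} (hL2 : 2 ≤ L) (M : ℕ) {ρ : ℕ} (hρ : L ≤ ρ)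
    {k : ℕ} (hk : 1 ≤ k) {β : ℝ} (hβ : 0 ≤ β) {len : Site d → ℝ} (hlen : ∀ z : Site d, z ≠ 0 → 1 ≤ len z) :
    ∃ B₀ B₀β cP : ℝ, 0 < B₀ ∧ 0 < B₀β ∧ 0 < cP ∧ ∀ (a : Site d) (η : ℝ), 0 < η →
      ∀ P : ℕ, L ^ k ∣ P → L ^ k * M + 2 * (ρ * gs L k) ≤ P →
      ∀ Λs : ℕ → ℕ → Set (Site d),
        (∀ j, j ≤ k → Λs k j = B11Eq7Convention.Lam L (periodize (fun _ : Fin d => P) (cubeFam true L a M ρ k)) k j) →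
        SockB9P3H2 (𝔸 := 𝔹) L B₀ B₀β cP β len η k (periodize (fun _ : Fin d => P) (cubeFam true L a M ρ k)) Λs
          (fun m j => towerBondsP L (periodize (fun _ : Fin d => P) (cubeFam true L a M ρ k)) (Λs m) j) := by
  obtain ⟨B₀, B₀β, cP, hB₀, hB₀β, hcP, H⟩ := socketLines_periodize (𝔹 := 𝔹) hd2 hL2 M hρ hk hβ hlen
  refine ⟨B₀, B₀β, cP, hB₀, hB₀β, hcP, fun a η hη P hdiv hP Λs hΛs => ?_⟩
  obtain ⟨q, hq⟩ := hdiv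
  exact H a η hη P q (by rw [hq]; push_cast; ring) hP _ Λs rfl hΛs
    (fun j p => p.2.2 ∈ AdmPair η len ∧ p.2.2.1 ∈ periodize (fun _ : Fin d => P) (cubeFam true L a M ρ k) j ∧
      p.2.2.2 ∈ periodize (fun _ : Fin d => P) (cubeFam true L a M ρ k) j) fun _ _ hp => hp.1

/-- ★★★ **THE SOCKET `SockB9P3` (Hölder pairs with the first point in `Ω_j`) ALSO HOLDS AT THE PERIODISED TOWER WITH `towerBondsP`, PER SHAPE.**
[cite: Balaban1985RegularSpaces, (1.57)–(1.59) p.86, (1.31) p.82, (1.131) p.99, p.77 («Ω_j = T_η»); Balaban1985BackgroundPropagators, Thm 3.3 p.399, (3.47) p.398; Balaban1984PropagatorsII, (2.1)–(2.3) p.224] -/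
theorem exists_sockB9P3_periodize [FiniteDimensional ℂ 𝔹] (hd2 : 2 ≤ d) {L : ℕ} (hL2 : 2 ≤ L) (M : ℕ) {ρ : ℕ} (hρ : L ≤ ρ)
    {k : ℕ} (hk : 1 ≤ k) {β : ℝ} (hβ : 0 ≤ β) {len : Site d → ℝ} (hlen : ∀ z : Site d, z ≠ 0 → 1 ≤ len z) :
    ∃ B₀ B₀β cP : ℝ, 0 < B₀ ∧ 0 < B₀β ∧ 0 < cP ∧ ∀ (a : Site d) (η : ℝ), 0 < η →
      ∀ P : ℕ, L ^ k ∣ P → L ^ k * M + 2 * (ρ * gs L k) ≤ P →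
      ∀ Λs : ℕ → ℕ → Set (Site d),
        (∀ j, j ≤ k → Λs k j = B11Eq7Convention.Lam L (periodize (fun _ : Fin d => P) (cubeFam true L a M ρ k)) k j) →
        SockB9P3 (𝔸 := 𝔹) L B₀ B₀β cP β len η k (periodize (fun _ : Fin d => P) (cubeFam true L a M ρ k)) Λs
          (fun m j => towerBondsP L (periodize (fun _ : Fin d => P) (cubeFam true L a M ρ k)) (Λs m) j) := by
  obtain ⟨B₀, B₀β, cP, hB₀, hB₀β, hcP, H⟩ := socketLines_periodize (𝔹 := 𝔹) hd2 hL2 M hρ hk hβ hlen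
  refine ⟨B₀, B₀β, cP, hB₀, hB₀β, hcP, fun a η hη P hdiv hP Λs hΛs => ?_⟩
  obtain ⟨q, hq⟩ := hdiv
  exact H a η hη P q (by rw [hq]; push_cast; ring) hP _ Λs rfl hΛs
    (fun j p => p.2.2 ∈ AdmPair η len ∧ p.2.2.1 ∈ periodize (fun _ : Fin d => P) (cubeFam true L a M ρ k) j) fun _ _ hp => hp.1

end Literature.MathematicalPhysics.QuantumFieldTheory.Balaban1983to89.B8SockB9P3H2AtPeriodizedTower
end
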